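import Literature.MathematicalPhysics.QuantumFieldTheory.Balaban1983to89.B13Core214Holomorphic
import Literature.MathematicalPhysics.QuantumFieldTheory.Balaban1983to89.NodeOJetFamily

/-!
# `Balaban1983to89.B13Core214EntryHolomorphic` — T. Bałaban, *Renormalization group approach to lattice gauge field
theories. II. Cluster expansions*, Commun. Math. Phys. **116** (1988) 1–22 [Balaban1988RG2Cluster], (2.14) p. 15 with
[I] = *Renormalization group approach to lattice gauge field theories. I*, Commun. Math. Phys. **109** (1987) 249–301
[Balaban1987RG1], (4.3)–(4.5) pp. 281–282: LINES 2–4 OF (2.14) ARE A HOLOMORPHIC FUNCTION OF THE FINITELY MANY KERNEL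
ENTRIES — the `X`-integral `∫dμ₀(X)|_Z exp(−½⟨ΓX, C^{(k)}ΓX⟩)∫dμ_{C^{(k)}}(B)exp(−⟨B, ΓX⟩)F(B)` (`B13Term214.core214`)
read as a function `Φ` on the ENTRY SPACE `ℂ^ι`, `ι = (Λ × (Λ ⊕ C₀)) ⊕ (Λ × Λ)` (the entries of `Γ_k(Z₀,σ)` and of the
precision `C^{(k)}(Z₀,σ)⁻¹`, `NodeOJetFamily.entries`), is jointly (Fréchet) holomorphic on every open set of entries on
which the (2.15)–(2.23) letters of `B13Core214Holomorphic.differentiableOn_core214X` hold; composed with a term's entry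
germ `u ↦ entries 𝒦 σ u` it IS that term's `core214` at the configuration `u`; hence, through
`NodeOJetFamily.Jet216R.objects_jet_agreement`, lines 2–4 of (2.14) have the same value, the same first `u`-derivative
and the same mixed second `u`-derivatives (the three read-outs of [I] (4.3)) at the base configuration on a term's
kernel family `𝒦` and on its jet family `kjet 𝒦`

statement-level skeleton of published theorems with citation tags; proofs where landed; nothing here is a claim about
the Yang–Mills mass gap

CITATION HEADER (verbatim, [Balaban1988RG2Cluster] p. 15 [PDF 15], after (2.14)): *"We consider it as an analytic
function of (𝐔, 𝐉) in the space 𝐔^c_{k+1}(X, α₀, α₁), and of the complex parameters σ(Z), τ. This complicates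
estimates of this expression, because the operators in it are not symmetric, and the second measure is complex."*;
same page, before (2.14): *"The quadratic forms and covariances in H(Z) are analytic functions on the space of
configurations (𝐔, 𝐉)"*.  [Balaban1987RG1] p. 281 (4.3): the coefficient is read off as a mixed second derivative of
the effective action in the background at the flat point.

WHY THIS FILE (row (D4) OWNER `b2b-balaban-beta-an4`, gen 118; the OBJECTS-SIDE half (J2′) of the price of the
second-order jet lift «W-jet2» recorded by the cell `ym-nodeO-ideate`, memo `ROUTE-P3.md` v3.15 §0.16 ∕ census C88:
«Bałaban's local factor on a finite torus is a holomorphic `Φ` of the finitely many kernel entries on NODE A's regime»,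
addressed there to «the objects seats (NODE 00 ∕ beta-an4)»).  `NodeOJetFamily.Jet216R.objects_jet_agreement` is
stated for EVERY holomorphic `Φ` of the entries on an open set met by both entry germs; what it leaves open is that
the objects of (2.14) ARE such a `Φ`.  For lines 2–4 of (2.14) AT FIXED PARAMETERS `(σ, τ)` this is a COROLLARY of the
tree: `B13Core214Holomorphic.differentiableOn_core214X` (cell `pub-balaban-gaps`, seat ne5) is already JOINT holomorphy
over an ARBITRARY complex parameter space `P`; taking `P := ℂ^ι` with the tautological readers (§1: the symmetrised
precision `symA e`, the Γ-matrix `matG e`, its real-linear action `linΓ e`) gives §2; the identification with a term's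
objects (§3) is definitional up to the symmetry of the precision (NODE A's per-configuration binder `hAs` of
`B13PrimitiveKernels216.h226_torus_of_kernelBounds`, inherited by the jet family: `NodeOJetFamily.kjet_A2_isSymm`) —
the reader `symA` SYMMETRISES because an open set of entries contains non-symmetric points while the complex Gaussian
machinery of (2.15) is typed for symmetric precisions; §4 is the junction with `objects_jet_agreement` BY NAME.

WHAT IS REPRODUCED:
* §1 `symA`, `matG`, `linΓ` (DATA: the (2.14)-operators read off a point of the entry space) and their bookkeeping
  (`symA_isSymm`, `symA_elim`, `matG_elim`, entrywise differentiability in the entries, continuity of `linΓ e`).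
* §2 **`differentiableOn_core214_entries`** — `e ↦ core214 symA linΓ F e τ` is `DifferentiableOn ℂ` on every open
  `V ⊆ ℂ^ι` carrying the letters of `differentiableOn_core214X` (`Re symA ≻ 0`, `R₁`, (2.17a∕b), `R₂`, `R₃` against a
  fixed real reference `(C, Γ₀)`, the last line's bound `‖F(τ,B)‖ ≤ Ke^{½a‖B‖²}` and measurability, `λ(C) ≤ c`,
  `⟨Γ₀X, CΓ₀X⟩ ≤ g‖X‖²`, `(2ρ+a)c ≤ ½`, `(2ρ+a)(1+2cg) < 1`).
* §3 `symA_entries`, `matG_entries`, `linΓ_entries`, **`core214_entries`** — at a configuration `u` where `A(σ,u)` is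
  symmetric, `(e ↦ core214 symA linΓ F e τ) (entries 𝒦 σ u)` = the term's `core214 (σ' ↦ A(σ',u)) (σ' ↦ G(σ',u)·) F σ τ`.
* §4 **`core214_jet_agreement`** — under the jet record `Jet216R`, the germ letters, symmetry of `A(σ,·)` on the ball
  and an open entry set `V` as in §2 met by both entry germs: value ∕ `fderiv` ∕ `mixedDeriv` at `u = 0` of
  `u ↦ core214` of `𝒦` and of `kjet 𝒦` agree (`objects_jet_agreement` with `Φ := e ↦ core214 symA linΓ F e τ`, then
  §3 on the ball by `Beta.RemainderLocality.mixedDeriv_congr_of_eqOn_ball` ∕ `Filter.EventuallyEq.fderiv_eq`).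
HONEST SCOPE.  Generic finite-dimensional complex analysis over the block model; the letters on `V` are HYPOTHESES
(which open `V` inside NODE A's regime carries them, and that a producer's entry germs map the ball into it, is the
consumer's numerics — not decided here); FIXED parameters `(σ, τ)`: the Cauchy operators of (2.14) in `σ(Δ)`, `τ(Y)`
(`B13Term214.term214`), the finite term sum of Lemma 3 and (2.13) are NOT transported here (that is the remaining part
of (J2′)), and (J3) — the (1.7)-factorisation of the jet objects — is untouched.  Nothing of Bałaban's `Γ_k(Z₀,σ)`,
`C^{(k)}(Z₀,σ)` is constructed or asserted; row (D4) instance 0∕1, T⁴ spine 0∕9 UNCHANGED; NOT NODE O, NOT [B12] Thm 2,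
NOT continuum, NOT mass gap, NOT Clay.  No `sorry`, no named fact, no instance, no notation; three `def`s (readers).
-/

noncomputable section

namespace Literature.MathematicalPhysics.QuantumFieldTheory.Balaban1983to89.B13Core214EntryHolomorphic

open Matrix MeasureTheory Finset Complex Metric Set Filter
open scoped Topology
open B13Term214 (cgaussMean integrand214 core214)
open B13Core214Holomorphic (differentiableOn_core214X)
open B13TermWalkData (TermKernels)
open B13JointWalkExpansion (JointWalkExpansion)
open NodeOJetCalculus (jet2)
open NodeOJetFamily (kjet entries Jet216R kjet_A2_isSymm)
open B12Decay510 (mixedDeriv)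
open Beta.RemainderLocality (mixedDeriv_congr_of_eqOn_ball)

/-! ## §1 The (2.14)-operators read off a point of the entry space `ℂ^ι`, `ι = (Λ × (Λ ⊕ C₀)) ⊕ (Λ × Λ)` -/

section Readers

variable {Λ C₀ : Type} [Fintype Λ] [DecidableEq Λ] [Fintype C₀] [DecidableEq C₀]

/-- The SYMMETRISED precision read off the `Λ × Λ` block of a point `e` of the entry space:
`(symA e)_{bb′} = ½(e_{bb′} + e_{b′b})`.  On the entries of a symmetric precision it is that precision (`symA_elim`);
it is symmetric at EVERY point (`symA_isSymm`), which is what lets the complex Gaussian objects of (2.14)–(2.15), typed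
for symmetric precisions, be read on an OPEN set of entries. DATA. [cite: Balaban1988RG2Cluster, (2.14) p.15] -/
def symA (e : (Λ × (Λ ⊕ C₀)) ⊕ (Λ × Λ) → ℂ) : Matrix Λ Λ ℂ :=
  Matrix.of fun b b' => (e (Sum.inr (b, b')) + e (Sum.inr (b', b))) / 2

/-- The matrix of `Γ_k(Z₀,σ)` read off the `Λ × (Λ ⊕ C₀)` block of a point of the entry space. DATA.
[cite: Balaban1988RG2Cluster, (2.14) p.15] -/
def matG (e : (Λ × (Λ ⊕ C₀)) ⊕ (Λ × Λ) → ℂ) : Matrix Λ (Λ ⊕ C₀) ℂ :=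
  Matrix.of fun b j => e (Sum.inl (b, j))

/-- The action of `Γ_k(Z₀,σ)` on the real white noise `X`, read off a point of the entry space:
`linΓ e X = matG e · X` (the shape `hlin` of `B13PrimitiveKernels216.h226_torus_of_kernelBounds`). DATA.
[cite: Balaban1988RG2Cluster, (2.14) p.15] -/
def linΓ (e : (Λ × (Λ ⊕ C₀)) ⊕ (Λ × Λ) → ℂ) (X : Λ ⊕ C₀ → ℝ) : Λ → ℂ :=
  matG e *ᵥ fun j => (X j : ℂ)

omit [Fintype Λ] [DecidableEq Λ] [Fintype C₀] [DecidableEq C₀] in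
/-- Entry formula of `symA` (definitional). [cite: Balaban1988RG2Cluster, (2.14) p.15] (elementary API for (2.14)) -/
@[simp] theorem symA_apply (e : (Λ × (Λ ⊕ C₀)) ⊕ (Λ × Λ) → ℂ) (b b' : Λ) :
    symA e b b' = (e (Sum.inr (b, b')) + e (Sum.inr (b', b))) / 2 := rfl

omit [Fintype Λ] [DecidableEq Λ] [Fintype C₀] [DecidableEq C₀] in
/-- Entry formula of `matG` (definitional). [cite: Balaban1988RG2Cluster, (2.14) p.15] (elementary API for (2.14)) -/
@[simp] theorem matG_apply (e : (Λ × (Λ ⊕ C₀)) ⊕ (Λ × Λ) → ℂ) (b : Λ) (j : Λ ⊕ C₀) :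
    matG e b j = e (Sum.inl (b, j)) := rfl

omit [DecidableEq Λ] [DecidableEq C₀] in
/-- Entry formula of `linΓ` (definitional). [cite: Balaban1988RG2Cluster, (2.14) p.15] (elementary API for (2.14)) -/
theorem linΓ_apply (e : (Λ × (Λ ⊕ C₀)) ⊕ (Λ × Λ) → ℂ) (X : Λ ⊕ C₀ → ℝ) (b : Λ) :
    linΓ e X b = ∑ j, e (Sum.inl (b, j)) * (X j : ℂ) := by
  simp only [linΓ, mulVec, dotProduct, matG_apply]

omit [Fintype Λ] [DecidableEq Λ] [Fintype C₀] [DecidableEq C₀] in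
/-- `symA e` is a symmetric matrix at EVERY point of the entry space. [folklore]
[cite: Balaban1988RG2Cluster, (2.14) p.15] (elementary API for (2.14)) -/
theorem symA_isSymm (e : (Λ × (Λ ⊕ C₀)) ⊕ (Λ × Λ) → ℂ) : (symA e).IsSymm :=
  Matrix.IsSymm.ext fun b b' => by simp only [symA_apply]; ring

omit [Fintype Λ] [DecidableEq Λ] [Fintype C₀] [DecidableEq C₀] in
/-- On the entries of a SYMMETRIC precision the symmetrised reader returns that precision.
[folklore] [cite: Balaban1988RG2Cluster, (2.14) p.15] (elementary API for (2.14)) -/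
theorem symA_elim (g : Matrix Λ (Λ ⊕ C₀) ℂ) {M : Matrix Λ Λ ℂ} (hM : M.IsSymm) :
    symA (Sum.elim (fun p : Λ × (Λ ⊕ C₀) => g p.1 p.2) (fun p : Λ × Λ => M p.1 p.2)) = M := by
  ext b b'
  simp only [symA_apply, Sum.elim_inr]
  rw [hM.apply b b']
  ring

omit [Fintype Λ] [DecidableEq Λ] [Fintype C₀] [DecidableEq C₀] in
/-- The Γ-reader returns the Γ-block. [folklore] [cite: Balaban1988RG2Cluster, (2.14) p.15] (elementary API for (2.14)) -/
theorem matG_elim (g : Matrix Λ (Λ ⊕ C₀) ℂ) (M : Matrix Λ Λ ℂ) :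
    matG (Sum.elim (fun p : Λ × (Λ ⊕ C₀) => g p.1 p.2) (fun p : Λ × Λ => M p.1 p.2)) = g := by
  ext b j
  simp only [matG_apply, Sum.elim_inl]

omit [DecidableEq Λ] [DecidableEq C₀] in
/-- Each entry of the symmetrised precision is a (linear, hence) holomorphic function on the entry space (sup norm on
`ℂ^ι`, `ι` finite). [folklore] [cite: Balaban1988RG2Cluster, (2.14) p.15] (elementary API for (2.14)) -/
theorem differentiable_symA_apply (b b' : Λ) :
    Differentiable ℂ fun e : (Λ × (Λ ⊕ C₀)) ⊕ (Λ × Λ) → ℂ => symA e b b' := by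
  have h : (fun e : (Λ × (Λ ⊕ C₀)) ⊕ (Λ × Λ) → ℂ => symA e b b')
      = fun e => (e (Sum.inr (b, b')) + e (Sum.inr (b', b))) * (2 : ℂ)⁻¹ := by
    funext e; rw [symA_apply, div_eq_mul_inv]
  rw [h]
  have h1 : Differentiable ℂ fun e : (Λ × (Λ ⊕ C₀)) ⊕ (Λ × Λ) → ℂ => e (Sum.inr (b, b')) :=
    differentiable_apply _
  have h2 : Differentiable ℂ fun e : (Λ × (Λ ⊕ C₀)) ⊕ (Λ × Λ) → ℂ => e (Sum.inr (b', b)) :=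
    differentiable_apply _
  exact Differentiable.mul_const (h1.add h2) _

omit [DecidableEq Λ] [DecidableEq C₀] in
/-- Each component of `linΓ e X` is a holomorphic function on the entry space (a finite sum of coordinates times
constants). [folklore] [cite: Balaban1988RG2Cluster, (2.14) p.15] (elementary API for (2.14)) -/
theorem differentiable_linΓ_apply (X : Λ ⊕ C₀ → ℝ) (b : Λ) :
    Differentiable ℂ fun e : (Λ × (Λ ⊕ C₀)) ⊕ (Λ × Λ) → ℂ => linΓ e X b := by
  have h : (fun e : (Λ × (Λ ⊕ C₀)) ⊕ (Λ × Λ) → ℂ => linΓ e X b)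
      = fun e => ∑ j, e (Sum.inl (b, j)) * (X j : ℂ) := by
    funext e; exact linΓ_apply e X b
  rw [h]
  refine Differentiable.fun_sum fun j _ => ?_
  have hj : Differentiable ℂ fun e : (Λ × (Λ ⊕ C₀)) ⊕ (Λ × Λ) → ℂ => e (Sum.inl (b, j)) :=
    differentiable_apply _
  exact Differentiable.mul_const hj _

omit [DecidableEq Λ] [DecidableEq C₀] in
/-- `X ↦ linΓ e X` is continuous (a real-linear map on a finite-dimensional space). [folklore]
[cite: Balaban1988RG2Cluster, (2.14) p.15] (elementary API for (2.14)) -/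
theorem continuous_linΓ (e : (Λ × (Λ ⊕ C₀)) ⊕ (Λ × Λ) → ℂ) : Continuous (linΓ e) := by
  refine continuous_pi fun b => ?_
  have h : (fun X : Λ ⊕ C₀ → ℝ => linΓ e X b) = fun X => ∑ j, e (Sum.inl (b, j)) * (X j : ℂ) := by
    funext X; exact linΓ_apply e X b
  rw [h]
  exact continuous_finsetSum _ fun j _ =>
    continuous_const.mul (Complex.continuous_ofReal.comp (continuous_apply j))

end Readers

/-! ## §2 Lines 2–4 of (2.14) are jointly holomorphic in the kernel entries -/

section Holomorphy

variable {Λ C₀ : Type} [Fintype Λ] [DecidableEq Λ] [Fintype C₀] [DecidableEq C₀]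

/-- **LINES 2–4 OF (2.14) ARE A HOLOMORPHIC FUNCTION OF THE KERNEL ENTRIES** (the objects-side half of «W-jet2»'s
price (J2′) at fixed parameters).  On every OPEN set `V` of the entry space `ℂ^ι` on which — for the symmetrised
precision `symA e` and the Γ-action `linΓ e` against a fixed real reference `(C ≻ 0, Γ₀)` — the letters of
`B13Core214Holomorphic.differentiableOn_core214X` hold (`Re symA e ≻ 0`; `R₁`; (2.17a), (2.17b); `R₂`; `R₃`; the last
line `F(τ,·)` strongly measurable with `‖F(τ,B)‖ ≤ Ke^{½a‖B‖²}`; `λ_k(C) ≤ c`, `⟨Γ₀X, CΓ₀X⟩ ≤ g‖X‖²`, `(2ρ+a)c ≤ ½`,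
`(2ρ+a)(1+2cg) < 1`), the function `e ↦ ∫dμ₀(X)|_Z (lines 2–4 of (2.14))` = `B13Term214.core214 symA linΓ F e τ` is
`DifferentiableOn ℂ` on `V` — `differentiableOn_core214X` over the parameter space `P := ℂ^ι` with the coordinate
readers of §1 (entrywise linear in `e`, `linΓ e` continuous in `X`, `F` constant in `e`).
[cite: Balaban1988RG2Cluster, (2.14)–(2.15) p.15, (2.16)–(2.22) p.16, (2.23) p.17; Chae1985, Thm 14.13] -/
theorem differentiableOn_core214_entries {D : Type*} (F : (D → ℂ) → (Λ → ℝ) → ℂ) (τ : D → ℂ)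
    {V : Set ((Λ × (Λ ⊕ C₀)) ⊕ (Λ × Λ) → ℂ)} (hV : IsOpen V)
    (hApos : ∀ e ∈ V, ((symA e).map Complex.re).PosDef)
    (hFm : StronglyMeasurable (F τ))
    {C : Matrix Λ Λ ℝ} (hC : C.PosDef) {Γ₀ : Matrix Λ (Λ ⊕ C₀) ℝ} {ρ a K c g η : ℝ}
    (hρ0 : 0 ≤ ρ) (ha0 : 0 ≤ a) (hK : 0 ≤ K)
    (hR1 : ∀ e ∈ V, ∀ X : Λ ⊕ C₀ → ℝ, -(1 / 2) * ((linΓ e X) ⬝ᵥ ((symA e)⁻¹ *ᵥ linΓ e X)).re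
      ≤ -(1 / 2 * ((Γ₀ *ᵥ X) ⬝ᵥ (C *ᵥ (Γ₀ *ᵥ X)))) + ρ / 2 * (X ⬝ᵥ X))
    (h17a : ∀ e ∈ V, Real.sqrt (‖(symA e).det‖ / ((symA e).map Complex.re).det) ≤ Real.exp (η * Fintype.card Λ))
    (h17b : ∀ e ∈ V, Real.sqrt (((symA e).map Complex.re).det / C⁻¹.det) ≤ Real.exp (η * Fintype.card Λ))
    (hR2 : ∀ e ∈ V, ∀ B : Λ → ℝ, B ⬝ᵥ ((C⁻¹ - (symA e).map Complex.re) *ᵥ B) ≤ ρ * (B ⬝ᵥ B))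
    (hR3 : ∀ e ∈ V, ∀ (X : Λ ⊕ C₀ → ℝ) (B : Λ → ℝ), -(B ⬝ᵥ fun i => (linΓ e X i).re)
      ≤ -(B ⬝ᵥ (Γ₀ *ᵥ X)) + ρ / 2 * (X ⬝ᵥ X + B ⬝ᵥ B))
    (hF : ∀ B, ‖F τ B‖ ≤ K * Real.exp (a / 2 * (B ⬝ᵥ B)))
    (hc0 : 0 ≤ c) (hc : ∀ k, hC.1.eigenvalues k ≤ c) (hαc : (2 * ρ + a) * c ≤ 1 / 2)
    (hΓ0 : ∀ X : Λ ⊕ C₀ → ℝ, (Γ₀ *ᵥ X) ⬝ᵥ (C *ᵥ (Γ₀ *ᵥ X)) ≤ g * (X ⬝ᵥ X))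
    (hsmall : (2 * ρ + a) * (1 + 2 * c * g) < 1) :
    DifferentiableOn ℂ (fun e => core214 symA linΓ F e τ) V := by
  show DifferentiableOn ℂ (fun e => cgaussMean (1 : Matrix (Λ ⊕ C₀) (Λ ⊕ C₀) ℂ)
    (integrand214 (symA e) (linΓ e) (F τ))) V
  exact differentiableOn_core214X (A := symA) (Γ := linΓ) (F := fun _ => F τ) hV
    (fun i j => (differentiable_symA_apply i j).differentiableOn) (fun e _ => symA_isSymm e) hApos
    (fun X i => (differentiable_linΓ_apply X i).differentiableOn) (fun e _ => continuous_linΓ e)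
    (fun _ => differentiableOn_const _) (fun _ _ => hFm) hC hρ0 ha0 hK hR1 h17a h17b hR2 hR3
    (fun _ _ B => hF B) hc0 hc hαc hΓ0 hsmall

end Holomorphy

/-! ## §3 On a term's entry germ the function of §2 IS the term's `core214` -/

section Identification

variable {c : B13.Consts} {d N' ν : ℕ} {Nf : Fin ν → ℕ} [∀ i, NeZero (Nf i)]
variable {E : Type*} [NormedAddCommGroup E] [NormedSpace ℂ E]

/-- The symmetrised precision read off a term's entries at `(σ, u)` is the term's precision `A(σ,u)` whenever the
latter is symmetric (NODE A's binder `hAs`). [folklore] [cite: Balaban1988RG2Cluster, (2.14)–(2.16) pp.15–16] -/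
theorem symA_entries (𝒦 : TermKernels c d N' ν Nf E) (σ : TreeLengthTorus.TPt d N' → ℂ) (u : E)
    (hs : (𝒦.A2 σ u).IsSymm) : symA (entries 𝒦 σ u) = 𝒦.A2 σ u :=
  symA_elim (𝒦.G2 σ u) hs

/-- The Γ-matrix read off a term's entries at `(σ, u)` is `G(σ,u)` (definitional). [folklore]
[cite: Balaban1988RG2Cluster, (2.14)–(2.16) pp.15–16] -/
theorem matG_entries (𝒦 : TermKernels c d N' ν Nf E) (σ : TreeLengthTorus.TPt d N' → ℂ) (u : E) :
    matG (entries 𝒦 σ u) = 𝒦.G2 σ u :=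
  matG_elim (𝒦.G2 σ u) (𝒦.A2 σ u)

/-- The Γ-action read off a term's entries at `(σ, u)` is `X ↦ G(σ,u)·X` — the shape `hlin` of NODE A's capstone
(definitional). [folklore] [cite: Balaban1988RG2Cluster, (2.14)–(2.16) pp.15–16] -/
theorem linΓ_entries (𝒦 : TermKernels c d N' ν Nf E) [Fintype 𝒦.C₀] (σ : TreeLengthTorus.TPt d N' → ℂ) (u : E)
    (X : 𝒦.Λ ⊕ 𝒦.C₀ → ℝ) : linΓ (entries 𝒦 σ u) X = 𝒦.G2 σ u *ᵥ fun j => (X j : ℂ) := by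
  unfold linΓ; rw [matG_entries]

/-- **THE IDENTIFICATION**: at a configuration `u` where the precision `A(σ,u)` is symmetric, the holomorphic function
of §2 evaluated at the term's entries IS lines 2–4 of (2.14) for the term at `(σ, u)` —
`core214 symA linΓ F (entries 𝒦 σ u) τ = core214 (σ' ↦ A(σ',u)) (σ' ↦ X ↦ G(σ',u)·X) F σ τ`. [folklore]
[cite: Balaban1988RG2Cluster, (2.14)–(2.16) pp.15–16] -/
theorem core214_entries (𝒦 : TermKernels c d N' ν Nf E) [Fintype 𝒦.C₀] [DecidableEq 𝒦.C₀] {D : Type*}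
    (F : (D → ℂ) → (𝒦.Λ → ℝ) → ℂ) (σ : TreeLengthTorus.TPt d N' → ℂ) (τ : D → ℂ) (u : E)
    (hs : (𝒦.A2 σ u).IsSymm) :
    core214 symA linΓ F (entries 𝒦 σ u) τ
      = core214 (fun σ' => 𝒦.A2 σ' u) (fun σ' X => 𝒦.G2 σ' u *ᵥ fun j => (X j : ℂ)) F σ τ := by
  have hΓ : linΓ (entries 𝒦 σ u) = fun X => 𝒦.G2 σ u *ᵥ fun j => (X j : ℂ) :=
    funext fun X => linΓ_entries 𝒦 σ u X
  simp only [core214, symA_entries 𝒦 σ u hs, hΓ]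

end Identification

/-! ## §4 The junction with `NodeOJetFamily.Jet216R.objects_jet_agreement`: lines 2–4 of (2.14) on the jet family -/

section Junction

variable {c : B13.Consts} {d N' ν : ℕ} {Nf : Fin ν → ℕ} [∀ i, NeZero (Nf i)]
variable {E : Type*} [NormedAddCommGroup E] [NormedSpace ℂ E]

/-- **LINES 2–4 OF (2.14) HAVE THE SAME SECOND-ORDER JET AT THE BASE CONFIGURATION ON A TERM'S KERNEL FAMILY AND ON
ITS JET FAMILY.**  Under the jet record `Jet216R` of `𝒦`, the germ letters `haE haΓ` on the `ρ`-ball, symmetry of the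
precision `A(σ,u)` for `u` in that ball, and an OPEN entry set `V` carrying the letters of §2 into which BOTH entry
germs `entries 𝒦 σ`, `entries (kjet 𝒦) σ` map the ball: the functions
`u ↦ core214 (A(·,u)) (G(·,u)·) F σ τ` of `𝒦` and of its jet family — every entry replaced by its second-order
Taylor polynomial `jet2 (u′ ↦ K(σ′,u′)_{bj}) u` at the base point (= `(kjet 𝒦).A2 ∕ .G2`, `NodeOJetFamily.kjet_A2_apply`
∕ `kjet_G2_apply`, definitionally) — have the same value, the same `fderiv` and the same `mixedDeriv v w`
([Balaban1987RG1] (4.3)) at `u = 0` — `objects_jet_agreement` with `Φ := e ↦ core214 symA linΓ F e τ`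
(holomorphic on `V` by §2), then §3 on the ball (`Beta.RemainderLocality.mixedDeriv_congr_of_eqOn_ball`,
`Filter.EventuallyEq.fderiv_eq`; on the jet side §3 holds at every `v` by `kjet_A2_isSymm`).
[cite: Balaban1987RG1, (4.3)–(4.5) pp.281–282; Balaban1988RG2Cluster, (2.14)–(2.16) pp.15–16; Chae1985, Thm 14.13] -/
theorem core214_jet_agreement (𝒦 : TermKernels c d N' ν Nf E) [Fintype 𝒦.C₀] [DecidableEq 𝒦.C₀]
    {kap KΓ K₀ θΓ θE K₁ K₂ : ℝ} (h : Jet216R 𝒦 kap KΓ K₀ θΓ θE K₁ K₂) {ρ : ℝ} (hρ : 0 < ρ)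
    (haE : JointWalkExpansion.AnalyticOnBall c 𝒦.A2 ρ) (haΓ : JointWalkExpansion.AnalyticOnBall c 𝒦.G2 ρ)
    (σ : TreeLengthTorus.TPt d N' → ℂ) (hσ : ∀ j, ‖σ j‖ ≤ Real.exp c.κ₁)
    (hs : ∀ u ∈ ball (0 : E) ρ, (𝒦.A2 σ u).IsSymm)
    {D : Type*} (F : (D → ℂ) → (𝒦.Λ → ℝ) → ℂ) (τ : D → ℂ)
    {V : Set ((𝒦.Λ × (𝒦.Λ ⊕ 𝒦.C₀)) ⊕ (𝒦.Λ × 𝒦.Λ) → ℂ)} (hV : IsOpen V)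
    (hApos : ∀ e ∈ V, ((symA e).map Complex.re).PosDef)
    (hFm : StronglyMeasurable (F τ))
    {C : Matrix 𝒦.Λ 𝒦.Λ ℝ} (hC : C.PosDef) {Γ₀ : Matrix 𝒦.Λ (𝒦.Λ ⊕ 𝒦.C₀) ℝ} {ρ' a K c' g η : ℝ}
    (hρ0 : 0 ≤ ρ') (ha0 : 0 ≤ a) (hK : 0 ≤ K)
    (hR1 : ∀ e ∈ V, ∀ X : 𝒦.Λ ⊕ 𝒦.C₀ → ℝ, -(1 / 2) * ((linΓ e X) ⬝ᵥ ((symA e)⁻¹ *ᵥ linΓ e X)).re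
      ≤ -(1 / 2 * ((Γ₀ *ᵥ X) ⬝ᵥ (C *ᵥ (Γ₀ *ᵥ X)))) + ρ' / 2 * (X ⬝ᵥ X))
    (h17a : ∀ e ∈ V, Real.sqrt (‖(symA e).det‖ / ((symA e).map Complex.re).det)
      ≤ Real.exp (η * Fintype.card 𝒦.Λ))
    (h17b : ∀ e ∈ V, Real.sqrt (((symA e).map Complex.re).det / C⁻¹.det) ≤ Real.exp (η * Fintype.card 𝒦.Λ))
    (hR2 : ∀ e ∈ V, ∀ B : 𝒦.Λ → ℝ, B ⬝ᵥ ((C⁻¹ - (symA e).map Complex.re) *ᵥ B) ≤ ρ' * (B ⬝ᵥ B))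
    (hR3 : ∀ e ∈ V, ∀ (X : 𝒦.Λ ⊕ 𝒦.C₀ → ℝ) (B : 𝒦.Λ → ℝ), -(B ⬝ᵥ fun i => (linΓ e X i).re)
      ≤ -(B ⬝ᵥ (Γ₀ *ᵥ X)) + ρ' / 2 * (X ⬝ᵥ X + B ⬝ᵥ B))
    (hF : ∀ B, ‖F τ B‖ ≤ K * Real.exp (a / 2 * (B ⬝ᵥ B)))
    (hc0 : 0 ≤ c') (hc : ∀ k, hC.1.eigenvalues k ≤ c') (hαc : (2 * ρ' + a) * c' ≤ 1 / 2)
    (hΓ0 : ∀ X : 𝒦.Λ ⊕ 𝒦.C₀ → ℝ, (Γ₀ *ᵥ X) ⬝ᵥ (C *ᵥ (Γ₀ *ᵥ X)) ≤ g * (X ⬝ᵥ X))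
    (hsmall : (2 * ρ' + a) * (1 + 2 * c' * g) < 1)
    (hkV : MapsTo (entries 𝒦 σ) (ball 0 ρ) V) (hk'V : MapsTo (entries (kjet 𝒦) σ) (ball 0 ρ) V) :
    (core214 (fun σ' => 𝒦.A2 σ' (0 : E)) (fun σ' X => 𝒦.G2 σ' (0 : E) *ᵥ fun j => (X j : ℂ)) F σ τ
        = core214 (fun σ' => Matrix.of fun b b' => jet2 (fun u' => 𝒦.A2 σ' u' b b') (0 : E))
            (fun σ' X => (Matrix.of fun b j => jet2 (fun u' => 𝒦.G2 σ' u' b j) (0 : E)) *ᵥ fun j => (X j : ℂ))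
            F σ τ) ∧
      fderiv ℂ (fun u : E => core214 (fun σ' => 𝒦.A2 σ' u) (fun σ' X => 𝒦.G2 σ' u *ᵥ fun j => (X j : ℂ)) F σ τ) 0
        = fderiv ℂ (fun u : E => core214 (fun σ' => Matrix.of fun b b' => jet2 (fun u' => 𝒦.A2 σ' u' b b') u)
            (fun σ' X => (Matrix.of fun b j => jet2 (fun u' => 𝒦.G2 σ' u' b j) u) *ᵥ fun j => (X j : ℂ))
            F σ τ) 0 ∧
      ∀ v w : E,
        mixedDeriv (fun u : E => core214 (fun σ' => 𝒦.A2 σ' u) (fun σ' X => 𝒦.G2 σ' u *ᵥ fun j => (X j : ℂ)) F σ τ)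
            v w
          = mixedDeriv (fun u : E => core214 (fun σ' => Matrix.of fun b b' => jet2 (fun u' => 𝒦.A2 σ' u' b b') u)
              (fun σ' X => (Matrix.of fun b j => jet2 (fun u' => 𝒦.G2 σ' u' b j) u) *ᵥ fun j => (X j : ℂ))
              F σ τ) v w := by
  -- the jet family has the same row ∕ column types (definitionally); register their instances
  letI : Fintype (kjet 𝒦).C₀ := ‹Fintype 𝒦.C₀›
  letI : DecidableEq (kjet 𝒦).C₀ := ‹DecidableEq 𝒦.C₀›
  -- §2: the entry function is holomorphic on `V`
  have hΦ : DifferentiableOn ℂ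
      (fun e : (𝒦.Λ × (𝒦.Λ ⊕ 𝒦.C₀)) ⊕ (𝒦.Λ × 𝒦.Λ) → ℂ => core214 symA linΓ F e τ) V :=
    differentiableOn_core214_entries F τ hV hApos hFm hC hρ0 ha0 hK hR1 h17a h17b hR2 hR3 hF hc0 hc hαc hΓ0 hsmall
  -- `objects_jet_agreement` with `Φ := e ↦ core214 symA linΓ F e τ`
  obtain ⟨h0, h1, h2⟩ := h.objects_jet_agreement hρ haE haΓ σ hσ hV hΦ hkV hk'V
  -- §3 on the ball (family) and everywhere (jet family)
  have hfam : EqOn ((fun e : (𝒦.Λ × (𝒦.Λ ⊕ 𝒦.C₀)) ⊕ (𝒦.Λ × 𝒦.Λ) → ℂ => core214 symA linΓ F e τ)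
        ∘ entries 𝒦 σ)
      (fun u : E => core214 (fun σ' => 𝒦.A2 σ' u) (fun σ' X => 𝒦.G2 σ' u *ᵥ fun j => (X j : ℂ)) F σ τ)
      (ball 0 ρ) := fun u hu => core214_entries 𝒦 F σ τ u (hs u hu)
  have hjet : ((fun e : (𝒦.Λ × (𝒦.Λ ⊕ 𝒦.C₀)) ⊕ (𝒦.Λ × 𝒦.Λ) → ℂ => core214 symA linΓ F e τ)
        ∘ entries (kjet 𝒦) σ)
      = (fun u : E => core214 (fun σ' => Matrix.of fun b b' => jet2 (fun u' => 𝒦.A2 σ' u' b b') u)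
          (fun σ' X => (Matrix.of fun b j => jet2 (fun u' => 𝒦.G2 σ' u' b j) u) *ᵥ fun j => (X j : ℂ))
          F σ τ) :=
    funext fun v => core214_entries (kjet 𝒦) F σ τ v (kjet_A2_isSymm 𝒦 σ hρ hs v)
  have hfamev : ((fun e : (𝒦.Λ × (𝒦.Λ ⊕ 𝒦.C₀)) ⊕ (𝒦.Λ × 𝒦.Λ) → ℂ => core214 symA linΓ F e τ)
        ∘ entries 𝒦 σ)
      =ᶠ[𝓝 (0 : E)] (fun u : E => core214 (fun σ' => 𝒦.A2 σ' u)
        (fun σ' X => 𝒦.G2 σ' u *ᵥ fun j => (X j : ℂ)) F σ τ) :=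
    hfam.eventuallyEq_of_mem (isOpen_ball.mem_nhds (mem_ball_self hρ))
  refine ⟨?_, ?_, fun v w => ?_⟩
  · exact ((hfam (mem_ball_self hρ)).symm.trans h0).trans (congrFun hjet 0)
  · rw [← hfamev.fderiv_eq, ← hjet]; exact h1
  · rw [← mixedDeriv_congr_of_eqOn_ball hρ hfam v w, ← hjet]; exact h2 v w

end Junction

end Literature.MathematicalPhysics.QuantumFieldTheory.Balaban1983to89.B13Core214EntryHolomorphic

end
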